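import Summits.CriticalPhenomena.PercolationContinuityZ3.Theorems.PercNearOneGluingNoHeavyLowerTailSunflowerLawJoinCertificate
import HarnessLib

/-!
# `NoHeavyLowerTail` (crux stmt-CriticalPhenomena-4575), abstract sunflower cubic at LAW level: the LAW REGION
# `W = {max(LA, LB) ≥ 0}` is closed under law-level JOIN and MEET, and every law of `W` is the law of a FOUR-POINT normal form

Support file (seat `prim-ineq-gen-2` gen 30; `--supports stmt-CriticalPhenomena-4575`).  Nothing is asserted about the crux; no `sorry`, no named
facts, standard axioms.  Memo: run/shared/lean/prim/prim-ineq-gen-2/LAW-REGION-GEN30.md §1–§3.  After `…SunflowerLawJoinCertificate`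
(`joinLaw`, `LAform`, `LBform`, the join-absorption certificate).

CONTEXT.  prim-ineq-prove-1's (C1-law) says that the cell vector `m = (b,c₁,c₂,c₃,a)` of every three-petal sunflower of up-sets under every
product measure lies in `W := {m : LA(m) ≥ 0 ∨ LB(m) ≥ 0}` (`LA = a·AG − e₃`, `LB = b·AG − e₃`, `AG = ab − e₂(c)`).  gen 29 showed that the two
boundary sheets `{LB = 0}`, `{LA = 0}` are filled by the product classes PC / PC* and probed "realizable = W" numerically.

RESULTS [this work]:
* `exists_normalForm_of_LBform_nonneg` — FOUR-POINT NORMAL FORMS (pure algebra): every `m ≥ 0` with `Σ m = 1`, `b > 0` and `LB(m) ≥ 0` IS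
  the iterated law-level join `lit₁(w₁) ∨ lit₂(w₂) ∨ lit₃(w₃) ∨ top(z)` of three petal literals and one core literal, with the EXPLICIT
  parameters `wᵢ = cᵢ/(b + cᵢ)`, `z = 1 − (b+c₁)(b+c₂)(b+c₃)/b²` in `[0,1]` (`normalForm_cells`: the cells of that join are
  `((1−z)q₁q₂q₃, (1−z)w₁q₂q₃, (1−z)q₁w₂q₃, (1−z)q₁q₂w₃, ·)`).  Dually (`dualLaw`) every law with `LA ≥ 0`, `a > 0` is a meet of co-literals.
  With the companion `…SunflowerLawJoin` (cells of a θ-join = `joinLaw` of the cells) this makes `W ∩ {ab > 0}` EXACTLY the set of laws of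
  sunflowers on four coordinates, so (C1-law) ⟺ "the realizable law region is `W`" ⟺ "every sunflower law is a four-point law".
* `inW_joinLaw`, `inW_meetLaw` — `W` (within the Gladkov orthant `m ≥ 0`, `AG ≥ 0`) IS CLOSED UNDER THE LAW-LEVEL JOIN AND MEET:
  if both factors have `LB ≥ 0` the down-cells multiply (`LBform_joinLaw_nonneg`); otherwise one factor has `LB < 0 ≤ LA`, hence `a > b`
  (`bot_le_top_of_LB_neg`), and the join-absorption certificate `LAform_joinLaw_nonneg` applies (after `joinLaw_comm` if needed); meet = join
  of duals.  Consequence (companion file): (C1-law) — hence the H-row and the other static corollaries — holds for every sunflower built from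
  one-point structures by θ-joins and θ-meets on disjoint supports (all "read-once `M₃`-formulas": the product classes PC = `C₁∨C₂∨C₃`,
  PC* = co-literal meets, their normal forms, series–parallel compositions …), a class on which (C1) is a genuine `p`-dependent switch.
* `AGform_joinLaw_eq` — Gladkov's slack of a join, manifestly nonnegative:
  `AG(x∨y) = y₀²AG(x) + y₀Σᵢyᵢ(AG(x) + xⱼx_k) + x₀(Σx)AG(y) + Σ_{i<j} yᵢyⱼ(AG(x) + x_k(x₀+xᵢ+xⱼ))`.
-/

noncomputable section

namespace Summit.CriticalPhenomena.PercolationContinuityZ3.Theorems.SunflowerPartition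

namespace LawRegion

open LawPencil

/-! ## The region `W` and the A-regime -/

/-- The LAW REGION `W` of (C1-law): cell vectors with `LA(m) ≥ 0 ∨ LB(m) ≥ 0`. [prim-ineq-prove-1 (C1-law), as a set] -/
def regionW : Set (Fin 5 → ℝ) := {m | 0 ≤ LAform m ∨ 0 ≤ LBform m}

/-- Membership in `W`, unfolded. [this work] -/
theorem mem_regionW {m : Fin 5 → ℝ} : m ∈ regionW ↔ 0 ≤ LAform m ∨ 0 ≤ LBform m := Iff.rfl

/-- `LA − LB = (a − b)·AG`. [prim-ineq-gen-2 gen 29 §1; restated] -/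
theorem LAform_sub_LBform (m : Fin 5 → ℝ) : LAform m - LBform m = (m 4 - m 0) * AGform m := by
  simp only [LAform, LBform]; ring

/-- If `LB(m) < 0 ≤ LA(m)` and `AG(m) ≥ 0` then the core outweighs the bottom: `b ≤ a` (indeed `b < a`). [this work] -/
theorem bot_le_top_of_LB_neg {m : Fin 5 → ℝ} (hAG : 0 ≤ AGform m) (hLB : LBform m < 0) (hLA : 0 ≤ LAform m) : m 0 ≤ m 4 := by
  by_contra h
  have h' : m 4 < m 0 := lt_of_not_ge h
  have h1 : (m 4 - m 0) * AGform m ≤ 0 := mul_nonpos_of_nonpos_of_nonneg (by linarith) hAG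
  have h2 := LAform_sub_LBform m
  linarith

/-- **`W` IS CLOSED UNDER THE LAW-LEVEL JOIN** (inside the Gladkov orthant). [this work] -/
theorem inW_joinLaw {x y : Fin 5 → ℝ} (hx : ∀ i, 0 ≤ x i) (hy : ∀ i, 0 ≤ y i) (hAGx : 0 ≤ AGform x) (hAGy : 0 ≤ AGform y)
    (hWx : x ∈ regionW) (hWy : y ∈ regionW) : (joinLaw x y) ∈ regionW := by
  by_cases hBx : 0 ≤ LBform x
  · by_cases hBy : 0 ≤ LBform y
    · exact Or.inr (LBform_joinLaw_nonneg hx hy hBx hBy)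
    · -- `y` is in the A-regime: absorb `x`
      have hBy' : LBform y < 0 := lt_of_not_ge hBy
      have hLAy : 0 ≤ LAform y := hWy.resolve_right hBy
      have hab : y 0 ≤ y 4 := bot_le_top_of_LB_neg hAGy hBy' hLAy
      rw [joinLaw_comm]
      exact Or.inl (LAform_joinLaw_nonneg hy hx hab hAGy hLAy hAGx)
  · have hBx' : LBform x < 0 := lt_of_not_ge hBx
    have hLAx : 0 ≤ LAform x := hWx.resolve_right hBx
    have hab : x 0 ≤ x 4 := bot_le_top_of_LB_neg hAGx hBx' hLAx
    exact Or.inl (LAform_joinLaw_nonneg hx hy hab hAGx hLAx hAGy)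

/-! ## Gladkov's slack of a join -/

/-- **Gladkov's slack of a join**, manifestly nonnegative decomposition. [this work] -/
theorem AGform_joinLaw_eq (x y : Fin 5 → ℝ) :
    AGform (joinLaw x y) = y 0 ^ 2 * AGform x
      + y 0 * (y 1 * (AGform x + x 2 * x 3) + y 2 * (AGform x + x 1 * x 3) + y 3 * (AGform x + x 1 * x 2))
      + x 0 * total x * AGform y
      + (y 1 * y 2 * (AGform x + x 3 * (x 0 + x 1 + x 2)) + y 1 * y 3 * (AGform x + x 2 * (x 0 + x 1 + x 3))
          + y 2 * y 3 * (AGform x + x 1 * (x 0 + x 2 + x 3))) := by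
  simp only [AGform, total, joinLaw_zero, joinLaw_one, joinLaw_two, joinLaw_three, joinLaw_four]; ring

/-- Gladkov's inequality survives the join. [this work] -/
theorem AGform_joinLaw_nonneg {x y : Fin 5 → ℝ} (hx : ∀ i, 0 ≤ x i) (hy : ∀ i, 0 ≤ y i) (hAGx : 0 ≤ AGform x)
    (hAGy : 0 ≤ AGform y) : 0 ≤ AGform (joinLaw x y) := by
  rw [AGform_joinLaw_eq]
  have := hx 0; have := hx 1; have := hx 2; have := hx 3; have := hx 4
  have := hy 0; have := hy 1; have := hy 2; have := hy 3; have := hy 4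
  have ht : 0 ≤ total x := by unfold total; positivity
  positivity

/-! ## Duality and the law-level meet -/

/-- The dual cell vector (swap core and bottom; petals fixed). [folklore] -/
def dualLaw (m : Fin 5 → ℝ) : Fin 5 → ℝ := ![m 4, m 1, m 2, m 3, m 0]

/-- Cells of the dual. [this work] -/
@[simp] theorem dualLaw_zero (m : Fin 5 → ℝ) : dualLaw m 0 = m 4 := rfl
/-- Cells of the dual. [this work] -/
@[simp] theorem dualLaw_one (m : Fin 5 → ℝ) : dualLaw m 1 = m 1 := rfl
/-- Cells of the dual. [this work] -/
@[simp] theorem dualLaw_two (m : Fin 5 → ℝ) : dualLaw m 2 = m 2 := rfl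
/-- Cells of the dual. [this work] -/
@[simp] theorem dualLaw_three (m : Fin 5 → ℝ) : dualLaw m 3 = m 3 := rfl
/-- Cells of the dual. [this work] -/
@[simp] theorem dualLaw_four (m : Fin 5 → ℝ) : dualLaw m 4 = m 0 := rfl

/-- Duality is an involution. [this work] -/
theorem dualLaw_dualLaw (m : Fin 5 → ℝ) : dualLaw (dualLaw m) = m := by
  ext i; fin_cases i <;> rfl

/-- Gladkov's slack is self-dual. [this work] -/
theorem AGform_dualLaw (m : Fin 5 → ℝ) : AGform (dualLaw m) = AGform m := by
  simp only [AGform, dualLaw_zero, dualLaw_one, dualLaw_two, dualLaw_three, dualLaw_four]; ring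

/-- Duality swaps the two slacks: `LA(m*) = LB(m)`. [this work] -/
theorem LAform_dualLaw (m : Fin 5 → ℝ) : LAform (dualLaw m) = LBform m := by
  simp only [LAform, LBform, AGform, dualLaw_zero, dualLaw_one, dualLaw_two, dualLaw_three, dualLaw_four]; ring

/-- Duality swaps the two slacks: `LB(m*) = LA(m)`. [this work] -/
theorem LBform_dualLaw (m : Fin 5 → ℝ) : LBform (dualLaw m) = LAform m := by
  simp only [LAform, LBform, AGform, dualLaw_zero, dualLaw_one, dualLaw_two, dualLaw_three, dualLaw_four]; ring

/-- `W` is self-dual. [this work] -/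
theorem inW_dualLaw {m : Fin 5 → ℝ} (h : m ∈ regionW) : (dualLaw m) ∈ regionW := by
  rcases h with h | h
  · exact Or.inr (by rw [LBform_dualLaw]; exact h)
  · exact Or.inl (by rw [LAform_dualLaw]; exact h)

/-- Nonnegativity passes to the dual. [this work] -/
theorem dualLaw_nonneg {m : Fin 5 → ℝ} (h : ∀ i, 0 ≤ m i) : ∀ i, 0 ≤ dualLaw m i := by
  intro i; fin_cases i <;> simp <;> exact h _

/-- **The law-level meet** (push-forward under the meet of `M₃`) as the dual of the join of the duals. [this work] -/
def meetLaw (x y : Fin 5 → ℝ) : Fin 5 → ℝ := dualLaw (joinLaw (dualLaw x) (dualLaw y))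

/-- The meet written out: top `x₄y₄`; petal `i`: `x₄yᵢ + xᵢy₄ + xᵢyᵢ`; bottom: the rest. [this work] -/
theorem meetLaw_eq (x y : Fin 5 → ℝ) : meetLaw x y =
    ![x 0 * (y 0 + y 1 + y 2 + y 3 + y 4) + y 0 * (x 4 + x 1 + x 2 + x 3) +
        (x 1 * y 2 + x 1 * y 3 + x 2 * y 1 + x 2 * y 3 + x 3 * y 1 + x 3 * y 2),
      x 4 * y 1 + x 1 * y 4 + x 1 * y 1, x 4 * y 2 + x 2 * y 4 + x 2 * y 2, x 4 * y 3 + x 3 * y 4 + x 3 * y 3, x 4 * y 4] := by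
  ext i
  fin_cases i <;>
    simp only [meetLaw, dualLaw, joinLaw, Fin.reduceFinMk, Fin.isValue, Matrix.cons_val_zero, Matrix.cons_val_one, Matrix.cons_val]
  ring

/-- **`W` IS CLOSED UNDER THE LAW-LEVEL MEET** (inside the Gladkov orthant). [this work] -/
theorem inW_meetLaw {x y : Fin 5 → ℝ} (hx : ∀ i, 0 ≤ x i) (hy : ∀ i, 0 ≤ y i) (hAGx : 0 ≤ AGform x) (hAGy : 0 ≤ AGform y)
    (hWx : x ∈ regionW) (hWy : y ∈ regionW) : (meetLaw x y) ∈ regionW := by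
  unfold meetLaw
  refine inW_dualLaw (inW_joinLaw (dualLaw_nonneg hx) (dualLaw_nonneg hy) ?_ ?_ (inW_dualLaw hWx) (inW_dualLaw hWy))
  · rw [AGform_dualLaw]; exact hAGx
  · rw [AGform_dualLaw]; exact hAGy

/-- Gladkov's inequality survives the meet. [this work] -/
theorem AGform_meetLaw_nonneg {x y : Fin 5 → ℝ} (hx : ∀ i, 0 ≤ x i) (hy : ∀ i, 0 ≤ y i) (hAGx : 0 ≤ AGform x)
    (hAGy : 0 ≤ AGform y) : 0 ≤ AGform (meetLaw x y) := by
  unfold meetLaw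
  rw [AGform_dualLaw]
  exact AGform_joinLaw_nonneg (dualLaw_nonneg hx) (dualLaw_nonneg hy) (by rw [AGform_dualLaw]; exact hAGx)
    (by rw [AGform_dualLaw]; exact hAGy)

/-! ## Literal laws and the four-point normal form -/

/-- The law of a PETAL LITERAL: one coordinate, label `C_i` when present (probability `w`), bottom otherwise. [this work] -/
def litLaw (i : Fin 5) (w : ℝ) : Fin 5 → ℝ := fun v => if v = 0 then 1 - w else if v = i then w else 0

/-- The law of a CORE LITERAL: one coordinate, label `⊤` when present (probability `z`), bottom otherwise. [this work] -/
def topLaw (z : ℝ) : Fin 5 → ℝ := ![1 - z, 0, 0, 0, z]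

/-- **The four-point normal form law** `lit₁(w₁) ∨ lit₂(w₂) ∨ lit₃(w₃) ∨ top(z)` (product class PC joined with a core literal). [this work] -/
def normalForm (w₁ w₂ w₃ z : ℝ) : Fin 5 → ℝ :=
  joinLaw (litLaw 1 w₁) (joinLaw (litLaw 2 w₂) (joinLaw (litLaw 3 w₃) (topLaw z)))

/-- The cells of the normal form (`qᵢ = 1 − wᵢ`): bottom `(1−z)q₁q₂q₃`, petal `i` `(1−z)wᵢqⱼq_k`, core the rest. [this work] -/
theorem normalForm_eq (w₁ w₂ w₃ z : ℝ) : normalForm w₁ w₂ w₃ z =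
    ![(1 - z) * (1 - w₁) * (1 - w₂) * (1 - w₃), (1 - z) * w₁ * (1 - w₂) * (1 - w₃), (1 - z) * (1 - w₁) * w₂ * (1 - w₃),
      (1 - z) * (1 - w₁) * (1 - w₂) * w₃,
      1 - (1 - z) * ((1 - w₁) * (1 - w₂) * (1 - w₃) + w₁ * (1 - w₂) * (1 - w₃) + (1 - w₁) * w₂ * (1 - w₃) +
        (1 - w₁) * (1 - w₂) * w₃)] := by
  ext i; fin_cases i <;> simp [normalForm, litLaw, topLaw] <;> ring

/-- The normal form is a probability vector for parameters in `[0,1]`. [this work] -/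
theorem normalForm_nonneg {w₁ w₂ w₃ z : ℝ} (h₁ : 0 ≤ w₁) (h₁' : w₁ ≤ 1) (h₂ : 0 ≤ w₂) (h₂' : w₂ ≤ 1) (h₃ : 0 ≤ w₃) (h₃' : w₃ ≤ 1)
    (hz : 0 ≤ z) (hz' : z ≤ 1) : ∀ i, 0 ≤ normalForm w₁ w₂ w₃ z i := by
  rw [normalForm_eq]
  have g₁ : 0 ≤ 1 - w₁ := by linarith
  have g₂ : 0 ≤ 1 - w₂ := by linarith
  have g₃ : 0 ≤ 1 - w₃ := by linarith
  have gz : 0 ≤ 1 - z := by linarith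
  intro i; fin_cases i
  · simp; positivity
  · simp; positivity
  · simp; positivity
  · simp; positivity
  · simp only [Fin.reduceFinMk, Matrix.cons_val]
    have e : 1 - ((1 - w₁) * (1 - w₂) * (1 - w₃) + w₁ * (1 - w₂) * (1 - w₃) + (1 - w₁) * w₂ * (1 - w₃) + (1 - w₁) * (1 - w₂) * w₃)
        = w₁ * w₂ * (1 - w₃) + w₁ * (1 - w₂) * w₃ + (1 - w₁) * w₂ * w₃ + w₁ * w₂ * w₃ := by ring
    have e' : 0 ≤ 1 - ((1 - w₁) * (1 - w₂) * (1 - w₃) + w₁ * (1 - w₂) * (1 - w₃) + (1 - w₁) * w₂ * (1 - w₃) +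
        (1 - w₁) * (1 - w₂) * w₃) := by rw [e]; positivity
    have f : 1 - (1 - z) * ((1 - w₁) * (1 - w₂) * (1 - w₃) + w₁ * (1 - w₂) * (1 - w₃) + (1 - w₁) * w₂ * (1 - w₃) +
        (1 - w₁) * (1 - w₂) * w₃) = z + (1 - z) * (1 - ((1 - w₁) * (1 - w₂) * (1 - w₃) + w₁ * (1 - w₂) * (1 - w₃) +
          (1 - w₁) * w₂ * (1 - w₃) + (1 - w₁) * (1 - w₂) * w₃)) := by ring
    rw [f]; positivity

/-- Lemma B is an IDENTITY on the normal forms with `z = 0` (the product class PC fills the sheet `{LB = 0}`) and in general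
`LB(normalForm) = z(1−z)²(q₁q₂q₃)²·(total)` — here with total mass `1`. [this work] -/
theorem LBform_normalForm (w₁ w₂ w₃ z : ℝ) :
    LBform (normalForm w₁ w₂ w₃ z) = z * (1 - z) ^ 2 * ((1 - w₁) * (1 - w₂) * (1 - w₃)) ^ 2 := by
  rw [normalForm_eq]; simp [LBform, AGform]; ring

/-- **FOUR-POINT NORMAL FORM THEOREM** (algebraic half of "realizable = W"): every nonnegative cell vector of total mass `1` with
positive bottom and `LB ≥ 0` equals `normalForm w₁ w₂ w₃ z` for the explicit parameters `wᵢ = cᵢ/(b+cᵢ)`,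
`z = 1 − (b+c₁)(b+c₂)(b+c₃)/b²`, all in `[0,1]`. [this work] -/
theorem exists_normalForm_of_LBform_nonneg {m : Fin 5 → ℝ} (hm : ∀ i, 0 ≤ m i) (htot : total m = 1) (hb : 0 < m 0)
    (hLB : 0 ≤ LBform m) :
    ∃ w₁ w₂ w₃ z : ℝ, (0 ≤ w₁ ∧ w₁ ≤ 1) ∧ (0 ≤ w₂ ∧ w₂ ≤ 1) ∧ (0 ≤ w₃ ∧ w₃ ≤ 1) ∧ (0 ≤ z ∧ z ≤ 1) ∧
      normalForm w₁ w₂ w₃ z = m := by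
  have h1 := hm 1; have h2 := hm 2; have h3 := hm 3; have h4 := hm 4
  have d1 : 0 < m 0 + m 1 := by linarith
  have d2 : 0 < m 0 + m 2 := by linarith
  have d3 : 0 < m 0 + m 3 := by linarith
  -- `LB ≥ 0` with total mass one says `(b+c₁)(b+c₂)(b+c₃) ≤ b²`
  have key : (m 0 + m 1) * (m 0 + m 2) * (m 0 + m 3) ≤ m 0 ^ 2 := by
    have e : LBform m = m 0 ^ 2 * total m - (m 0 + m 1) * (m 0 + m 2) * (m 0 + m 3) := by
      simp only [LBform, AGform, total]; ring
    rw [htot] at e; linarith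
  refine ⟨m 1 / (m 0 + m 1), m 2 / (m 0 + m 2), m 3 / (m 0 + m 3), 1 - (m 0 + m 1) * (m 0 + m 2) * (m 0 + m 3) / m 0 ^ 2,
    ⟨by positivity, (div_le_one d1).mpr (by linarith)⟩, ⟨by positivity, (div_le_one d2).mpr (by linarith)⟩,
    ⟨by positivity, (div_le_one d3).mpr (by linarith)⟩, ⟨?_, ?_⟩, ?_⟩
  · rw [sub_nonneg, div_le_one (by positivity)]; exact key
  · have : 0 ≤ (m 0 + m 1) * (m 0 + m 2) * (m 0 + m 3) / m 0 ^ 2 := by positivity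
    linarith
  · have hb' : m 0 ≠ 0 := hb.ne'
    have htot' : m 4 = 1 - m 0 - m 1 - m 2 - m 3 := by unfold total at htot; linarith
    rw [normalForm_eq]
    ext i; fin_cases i
    · simp; field_simp; ring
    · simp; field_simp; ring
    · simp; field_simp; ring
    · simp; field_simp; ring
    · simp only [Fin.reduceFinMk, Matrix.cons_val]; rw [htot']; field_simp; ring

/-- Dually: every law with positive core and `LA ≥ 0` is the dual (a meet of co-literals) of a normal form. [this work] -/
theorem exists_dual_normalForm_of_LAform_nonneg {m : Fin 5 → ℝ} (hm : ∀ i, 0 ≤ m i) (htot : total m = 1) (ha : 0 < m 4)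
    (hLA : 0 ≤ LAform m) :
    ∃ w₁ w₂ w₃ z : ℝ, (0 ≤ w₁ ∧ w₁ ≤ 1) ∧ (0 ≤ w₂ ∧ w₂ ≤ 1) ∧ (0 ≤ w₃ ∧ w₃ ≤ 1) ∧ (0 ≤ z ∧ z ≤ 1) ∧
      dualLaw (normalForm w₁ w₂ w₃ z) = m := by
  have htot' : total (dualLaw m) = 1 := by unfold total at *; simp; linarith
  obtain ⟨w₁, w₂, w₃, z, g₁, g₂, g₃, gz, h⟩ :=
    exists_normalForm_of_LBform_nonneg (dualLaw_nonneg hm) htot' (by simpa using ha) (by rw [LBform_dualLaw]; exact hLA)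
  exact ⟨w₁, w₂, w₃, z, g₁, g₂, g₃, gz, by rw [h, dualLaw_dualLaw]⟩

/-- **Every law of `W` with `ab > 0` is a four-point law** (a normal form or the dual of one). [this work] -/
theorem exists_normalForm_of_inW {m : Fin 5 → ℝ} (hm : ∀ i, 0 ≤ m i) (htot : total m = 1) (hb : 0 < m 0) (ha : 0 < m 4)
    (hW : m ∈ regionW) :
    ∃ w₁ w₂ w₃ z : ℝ, (0 ≤ w₁ ∧ w₁ ≤ 1) ∧ (0 ≤ w₂ ∧ w₂ ≤ 1) ∧ (0 ≤ w₃ ∧ w₃ ≤ 1) ∧ (0 ≤ z ∧ z ≤ 1) ∧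
      (normalForm w₁ w₂ w₃ z = m ∨ dualLaw (normalForm w₁ w₂ w₃ z) = m) := by
  rcases hW with h | h
  · obtain ⟨w₁, w₂, w₃, z, g₁, g₂, g₃, gz, e⟩ := exists_dual_normalForm_of_LAform_nonneg hm htot ha h
    exact ⟨w₁, w₂, w₃, z, g₁, g₂, g₃, gz, Or.inr e⟩
  · obtain ⟨w₁, w₂, w₃, z, g₁, g₂, g₃, gz, e⟩ := exists_normalForm_of_LBform_nonneg hm htot hb h
    exact ⟨w₁, w₂, w₃, z, g₁, g₂, g₃, gz, Or.inl e⟩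

/-- Conversely the normal forms lie in `W` (on the sheet side `LB ≥ 0`), for all parameters in `[0,1]`. [this work] -/
theorem inW_normalForm {w₁ w₂ w₃ z : ℝ} (hz : 0 ≤ z) : (normalForm w₁ w₂ w₃ z) ∈ regionW := by
  refine Or.inr ?_
  rw [LBform_normalForm]
  positivity

end LawRegion

end Summit.CriticalPhenomena.PercolationContinuityZ3.Theorems.SunflowerPartition
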